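import Summits.KontsevichZagierPeriods.KontsevichZagierPeriods.Theorems.RootDecompRationalCubeDichotomyArctanFibreP8

/-!
# Arctan-fibre calculus for `RationalCubePiKernelSingle` (route `RootDecompRationalCubeDichotomy`, crux stmt-KontsevichZagierPeriods-26322) at `m = 2` · part 9/9

Cell `decomp-kz`, lens 2 (decomp-kz-lens-2 g7): the GENERIC (arctan-fibre) side of the first open rung `m = 2` of
`RationalCubePiKernelSingle` decided INSIDE the Kontsevich–Zagier calculus with `N = 0`, by rules 1+2 only: fibred Möbius
charts `x ↦ x(q+r)/(q+rx)` (`MoebiusData.rel`), the TANGENT-ADDITION chart `x ↦ x(1−p)/(1−px²)` = the group law of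
`tan` as a move (`TanData.tan_add`), Serret's base involution `y ↦ (1−y)/(1+y)` (`rel_serret`), one moving-centre
dissection with null surgery (§8), odd-symmetry vanishing (§7b).  Decided census classes: `π·log 2` (`pilog2_rel`,
census pair #33), Catalan (`catalan_rel`, #32), dilogarithm classes `dilogA_rel` (#28), `dilogB_rel` (#30),
`dilogC_rel` (#24), seven moment relations; §9 the LITERAL binder instances of `RationalCubePiKernelSingle` at
`m = 2`, `N = 0` (the route decl is not referenced by name, so these modules do not import the route file);
§10 six UNIFORM CLASSES `single_classSwap/Reflect/Halve/Moebius/Serret/TanAdd`.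

Source: `HOME/decomp-kz-lens-2/g7/ArctanFibreCalculus.lean` sha256 964497cf335d1c59 (2144 l; critic decomp-kz-crit-1 g2
CLEARED 2026-08-30T09:13:02Z incl. transcription numerics, std axioms), split into 9 modules by the landing seat
decomp-kz-census-1 g7 (contexts re-opened per part; generic docstrings added where the source had none).
No `sorry`; standard axioms.  References: [cite: KontsevichZagier2001, §1.2]; J.-A. Serret (1844).
-/

noncomputable section

open Set MeasureTheory MvPolynomial
open Literature.ModelTheory.ExponentialFields (IsSemialgebraic)
open Literature.NumberTheory.Transcendental
open Literature.NumberTheory.Transcendental.KZ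
open Literature.NumberTheory.Transcendental.KZ.RFun
open Summit.KontsevichZagierPeriods.KontsevichZagierPeriods.Theorems

namespace Summit.KontsevichZagierPeriods.RootDecompRationalCubeDichotomy.ArctanFibre

-- PRIVATE copy (landed twin elsewhere / dedup.landed): snoc_two_zero, snoc_two_one, init_apply_zero, vec_zero, vec_one
/-- `snoc_two_zero`: auxiliary theorem of the arctan-fibre calculus for `RationalCubePiKernelSingle` (stmt-26322) — see the module docstring; verbatim from the lens file. -/
@[simp] private theorem snoc_two_zero (y : Fin 1 → ℝ) (s : ℝ) : (Fin.snoc y s : Fin 2 → ℝ) 0 = y 0 := rfl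

/-- `snoc_two_one`: auxiliary theorem of the arctan-fibre calculus for `RationalCubePiKernelSingle` (stmt-26322) — see the module docstring; verbatim from the lens file. -/
@[simp] private theorem snoc_two_one (y : Fin 1 → ℝ) (s : ℝ) : (Fin.snoc y s : Fin 2 → ℝ) 1 = s := rfl

/-- `init_apply_zero`: auxiliary theorem of the arctan-fibre calculus for `RationalCubePiKernelSingle` (stmt-26322) — see the module docstring; verbatim from the lens file. -/
@[simp] private theorem init_apply_zero (z : Fin 2 → ℝ) : Fin.init z 0 = z 0 := rfl

/-- `vec_zero`: auxiliary theorem of the arctan-fibre calculus for `RationalCubePiKernelSingle` (stmt-26322) — see the module docstring; verbatim from the lens file. -/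
@[simp] private theorem vec_zero (a b : ℝ) : (![a, b] : Fin 2 → ℝ) 0 = a := rfl

/-- `vec_one`: auxiliary theorem of the arctan-fibre calculus for `RationalCubePiKernelSingle` (stmt-26322) — see the module docstring; verbatim from the lens file. -/
@[simp] private theorem vec_one (a b : ℝ) : (![a, b] : Fin 2 → ℝ) 1 = b := rfl

section Instances

/-- `… (2, 1 − 2x, G_a)` (moment entry of the Catalan class). -/
theorem single_instMomGaodd (q : KZ.IntegralRep 2)
    (hdom : q.domain = Set.pi Set.univ (fun _ : Fin 2 => Set.Icc (0 : ℝ) 1))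
    (_hQ : ∀ z ∈ Set.pi Set.univ (fun _ : Fin 2 => Set.Icc (0 : ℝ) 1),
      MvPolynomial.aeval z mGaodd.den ≠ 0)
    (hint : ∀ z ∈ Set.pi Set.univ (fun _ : Fin 2 => Set.Icc (0 : ℝ) 1),
      q.integrand z = MvPolynomial.aeval z mGaodd.num / MvPolynomial.aeval z mGaodd.den)
    (_hv : q.value = 0) :
    ∃ N : ℕ, (fun y : KZ.FormalRep => KZ.of KZ.piRep * y)^[N] (KZ.of q) ∈ KZ.relations :=
  single_of_rel mGaodd mGaodd_rel q hdom hint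

/-- `… (2, x − 2xy, G_a)` (moment entry of the Catalan class). -/
theorem single_instMomGaodd2 (q : KZ.IntegralRep 2)
    (hdom : q.domain = Set.pi Set.univ (fun _ : Fin 2 => Set.Icc (0 : ℝ) 1))
    (_hQ : ∀ z ∈ Set.pi Set.univ (fun _ : Fin 2 => Set.Icc (0 : ℝ) 1),
      MvPolynomial.aeval z mGaodd2.den ≠ 0)
    (hint : ∀ z ∈ Set.pi Set.univ (fun _ : Fin 2 => Set.Icc (0 : ℝ) 1),
      q.integrand z = MvPolynomial.aeval z mGaodd2.num / MvPolynomial.aeval z mGaodd2.den)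
    (_hv : q.value = 0) :
    ∃ N : ℕ, (fun y : KZ.FormalRep => KZ.of KZ.piRep * y)^[N] (KZ.of q) ∈ KZ.relations :=
  single_of_rel mGaodd2 mGaodd2_rel q hdom hint

/-- `… (2, y − x, G_a)` (moment entry of the Catalan class). -/
theorem single_instMomGaanti (q : KZ.IntegralRep 2)
    (hdom : q.domain = Set.pi Set.univ (fun _ : Fin 2 => Set.Icc (0 : ℝ) 1))
    (_hQ : ∀ z ∈ Set.pi Set.univ (fun _ : Fin 2 => Set.Icc (0 : ℝ) 1),
      MvPolynomial.aeval z mGaanti.den ≠ 0)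
    (hint : ∀ z ∈ Set.pi Set.univ (fun _ : Fin 2 => Set.Icc (0 : ℝ) 1),
      q.integrand z = MvPolynomial.aeval z mGaanti.num / MvPolynomial.aeval z mGaanti.den)
    (_hv : q.value = 0) :
    ∃ N : ℕ, (fun y : KZ.FormalRep => KZ.of KZ.piRep * y)^[N] (KZ.of q) ∈ KZ.relations :=
  single_of_rel mGaanti mGaanti_rel q hdom hint

/-- `… (2, dMomGa.num, dMomGa.den)` (moment entry `x/G_a` vs `1/G_b`). -/
theorem single_instMomGa (q : KZ.IntegralRep 2)
    (hdom : q.domain = Set.pi Set.univ (fun _ : Fin 2 => Set.Icc (0 : ℝ) 1))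
    (_hQ : ∀ z ∈ Set.pi Set.univ (fun _ : Fin 2 => Set.Icc (0 : ℝ) 1),
      MvPolynomial.aeval z dMomGa.den ≠ 0)
    (hint : ∀ z ∈ Set.pi Set.univ (fun _ : Fin 2 => Set.Icc (0 : ℝ) 1),
      q.integrand z = MvPolynomial.aeval z dMomGa.num / MvPolynomial.aeval z dMomGa.den)
    (_hv : q.value = 0) :
    ∃ N : ℕ, (fun y : KZ.FormalRep => KZ.of KZ.piRep * y)^[N] (KZ.of q) ∈ KZ.relations :=
  single_of_rel dMomGa dMomGa_rel q hdom hint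

end Instances

/-! ## 10. Uniform classes of `RationalCubePiKernelSingle` (`m = 2`), all with `N = 0`

Each structural move of §§1–4 decides a whole CLASS of instances of item 26322 uniformly: the
difference `D` is presented as the formal `RFun` combination, the side condition is a pointwise
identity of rational functions on the square (a polynomial identity after clearing denominators). -/

section Classes

/-- **K-SWAP class**: `D = T − T∘swap`. -/
theorem single_classSwap (T : RFun 2)
    (q : KZ.IntegralRep 2)
    (hdom : q.domain = Set.pi Set.univ (fun _ : Fin 2 => Set.Icc (0 : ℝ) 1))
    (_hQ : ∀ z ∈ Set.pi Set.univ (fun _ : Fin 2 => Set.Icc (0 : ℝ) 1),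
      MvPolynomial.aeval z (T.sub (swap T)).den ≠ 0)
    (hint : ∀ z ∈ Set.pi Set.univ (fun _ : Fin 2 => Set.Icc (0 : ℝ) 1),
      q.integrand z = MvPolynomial.aeval z (T.sub (swap T)).num / MvPolynomial.aeval z (T.sub (swap T)).den)
    (_hv : q.value = 0) :
    ∃ N : ℕ, (fun y : KZ.FormalRep => KZ.of KZ.piRep * y)^[N] (KZ.of q) ∈ KZ.relations :=
  single_of_rel _ (by simpa using add_mem (rel_sub T (swap T)) (rel_swap T)) q hdom hint

/-- **K-REFLECT class**: `D = T∘(x_j ↦ 1 − x_j) − T`. -/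
theorem single_classReflect (j : Fin 2) (T : RFun 2)
    (q : KZ.IntegralRep 2)
    (hdom : q.domain = Set.pi Set.univ (fun _ : Fin 2 => Set.Icc (0 : ℝ) 1))
    (_hQ : ∀ z ∈ Set.pi Set.univ (fun _ : Fin 2 => Set.Icc (0 : ℝ) 1),
      MvPolynomial.aeval z ((reflect j T).sub T).den ≠ 0)
    (hint : ∀ z ∈ Set.pi Set.univ (fun _ : Fin 2 => Set.Icc (0 : ℝ) 1),
      q.integrand z = MvPolynomial.aeval z ((reflect j T).sub T).num / MvPolynomial.aeval z ((reflect j T).sub T).den)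
    (_hv : q.value = 0) :
    ∃ N : ℕ, (fun y : KZ.FormalRep => KZ.of KZ.piRep * y)^[N] (KZ.of q) ∈ KZ.relations :=
  single_of_rel _ (by simpa using add_mem (rel_sub (reflect j T) T) (rel_reflect j T)) q hdom hint

/-- **K-HALVE class** (cubical subdivision): `D = T − T₁ − T₂` with `T₁ = ½ T(x_i/2)`,
`T₂ = ½ T((1+x_i)/2)` pointwise. -/
theorem single_classHalve (i : Fin 2) (T T₁ T₂ : RFun 2)
    (h₁ : ∀ x ∈ KZ.cube 2, T₁.fn x = (1 / 2 : ℝ) * T.fn (Function.update x i (x i / 2)))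
    (h₂ : ∀ x ∈ KZ.cube 2, T₂.fn x = (1 / 2 : ℝ) * T.fn (Function.update x i ((1 + x i) / 2)))
    (q : KZ.IntegralRep 2)
    (hdom : q.domain = Set.pi Set.univ (fun _ : Fin 2 => Set.Icc (0 : ℝ) 1))
    (_hQ : ∀ z ∈ Set.pi Set.univ (fun _ : Fin 2 => Set.Icc (0 : ℝ) 1),
      MvPolynomial.aeval z ((T.sub T₁).sub T₂).den ≠ 0)
    (hint : ∀ z ∈ Set.pi Set.univ (fun _ : Fin 2 => Set.Icc (0 : ℝ) 1),
      q.integrand z = MvPolynomial.aeval z ((T.sub T₁).sub T₂).num / MvPolynomial.aeval z ((T.sub T₁).sub T₂).den)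
    (_hv : q.value = 0) :
    ∃ N : ℕ, (fun y : KZ.FormalRep => KZ.of KZ.piRep * y)^[N] (KZ.of q) ∈ KZ.relations :=
  single_of_rel _ (by
    have h := add_mem (add_mem (rel_sub (T.sub T₁) T₂) (rel_sub T T₁)) (rel_halve i T T₁ T₂ h₁ h₂)
    convert h using 1
    abel) q hdom hint

/-- **K-MOEBIUS class** (fibred Möbius charts `x ↦ x(q+r)/(q+rx)`, `q, q+r > 0` on `[0,1]`):
`D = T − S` whenever `T = (S∘U)·∂ₓU` pointwise. -/
theorem single_classMoebius (μ : MoebiusData) (T S : RFun 2)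
    (hTS : ∀ z ∈ KZ.cube 2, T.fn z =
      S.fn ![z 0, z 1 * (μ.q (z 0) + μ.r (z 0)) / (μ.q (z 0) + μ.r (z 0) * z 1)] *
        ((μ.q (z 0) + μ.r (z 0)) * μ.q (z 0) / (μ.q (z 0) + μ.r (z 0) * z 1) ^ 2))
    (q : KZ.IntegralRep 2)
    (hdom : q.domain = Set.pi Set.univ (fun _ : Fin 2 => Set.Icc (0 : ℝ) 1))
    (_hQ : ∀ z ∈ Set.pi Set.univ (fun _ : Fin 2 => Set.Icc (0 : ℝ) 1),
      MvPolynomial.aeval z (T.sub S).den ≠ 0)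
    (hint : ∀ z ∈ Set.pi Set.univ (fun _ : Fin 2 => Set.Icc (0 : ℝ) 1),
      q.integrand z = MvPolynomial.aeval z (T.sub S).num / MvPolynomial.aeval z (T.sub S).den)
    (_hv : q.value = 0) :
    ∃ N : ℕ, (fun y : KZ.FormalRep => KZ.of KZ.piRep * y)^[N] (KZ.of q) ∈ KZ.relations :=
  single_of_rel _ (by simpa using add_mem (rel_sub T S) (μ.rel T S hTS)) q hdom hint

/-- **K-SERRET class** (base chart `y ↦ (1−y)/(1+y)`): `D = F − G` whenever
`F(y,x) = G((1−y)/(1+y), x)·2/(1+y)²` pointwise. -/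
theorem single_classSerret (F G : RFun 2)
    (h : ∀ z ∈ KZ.cube 2, F.fn z = G.fn ![serret (z 0), z 1] * (2 / (1 + z 0) ^ 2))
    (q : KZ.IntegralRep 2)
    (hdom : q.domain = Set.pi Set.univ (fun _ : Fin 2 => Set.Icc (0 : ℝ) 1))
    (_hQ : ∀ z ∈ Set.pi Set.univ (fun _ : Fin 2 => Set.Icc (0 : ℝ) 1),
      MvPolynomial.aeval z (F.sub G).den ≠ 0)
    (hint : ∀ z ∈ Set.pi Set.univ (fun _ : Fin 2 => Set.Icc (0 : ℝ) 1),
      q.integrand z = MvPolynomial.aeval z (F.sub G).num / MvPolynomial.aeval z (F.sub G).den)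
    (_hv : q.value = 0) :
    ∃ N : ℕ, (fun y : KZ.FormalRep => KZ.of KZ.piRep * y)^[N] (KZ.of q) ∈ KZ.relations :=
  single_of_rel _ (by simpa using add_mem (rel_sub F G) (rel_serret F G h)) q hdom hint

/-- **K-TAN class** (tangent addition in the fibre): `D = T₁ + T₂ − T₃` for the three arctangent
densities of slopes `a₁, a₂, (a₁+a₂)/(1−a₁a₂)` with a common weight `w(y)`. -/
theorem single_classTanAdd (τ : TanData) (w : ℝ → ℝ) (T₁ T₂ T₃ : RFun 2)
    (hT₁ : ∀ z ∈ KZ.cube 2, T₁.fn z = w (z 0) * τ.a₁ (z 0) / (1 + (τ.a₁ (z 0) * z 1) ^ 2))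
    (hT₂ : ∀ z ∈ KZ.cube 2, T₂.fn z = w (z 0) * τ.a₂ (z 0) / (1 + (τ.a₂ (z 0) * z 1) ^ 2))
    (hT₃ : ∀ z ∈ KZ.cube 2, T₃.fn z =
      w (z 0) * (τ.a₁ (z 0) + τ.a₂ (z 0)) * (1 - τ.a₁ (z 0) * τ.a₂ (z 0)) /
        ((1 - τ.a₁ (z 0) * τ.a₂ (z 0)) ^ 2 + ((τ.a₁ (z 0) + τ.a₂ (z 0)) * z 1) ^ 2))
    (q : KZ.IntegralRep 2)
    (hdom : q.domain = Set.pi Set.univ (fun _ : Fin 2 => Set.Icc (0 : ℝ) 1))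
    (_hQ : ∀ z ∈ Set.pi Set.univ (fun _ : Fin 2 => Set.Icc (0 : ℝ) 1),
      MvPolynomial.aeval z ((T₁.add T₂).sub T₃).den ≠ 0)
    (hint : ∀ z ∈ Set.pi Set.univ (fun _ : Fin 2 => Set.Icc (0 : ℝ) 1),
      q.integrand z = MvPolynomial.aeval z ((T₁.add T₂).sub T₃).num / MvPolynomial.aeval z ((T₁.add T₂).sub T₃).den)
    (_hv : q.value = 0) :
    ∃ N : ℕ, (fun y : KZ.FormalRep => KZ.of KZ.piRep * y)^[N] (KZ.of q) ∈ KZ.relations :=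
  single_of_rel _ (by
    have h := add_mem (add_mem (rel_sub (T₁.add T₂) T₃) (rel_add T₁ T₂))
      (τ.tan_add w T₁ T₂ T₃ hT₁ hT₂ hT₃)
    convert h using 1
    abel) q hdom hint

end Classes

end Summit.KontsevichZagierPeriods.RootDecompRationalCubeDichotomy.ArctanFibre

end
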